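import Mathlib
import HarnessLib
import Literature.Analysis.FluidPDE.VorticityCalculus
import Summits.NavierStokesRegularity.NavierStokesRegularity.Theorems.PoloidalWindowDoorPoloidalWindowRigidityWindow
import Summits.NavierStokesRegularity.NavierStokesRegularity.Theorems.PoloidalWindowDoorPoloidalWindowRigidityLeafUniformPins
import Summits.NavierStokesRegularity.NavierStokesRegularity.Theorems.PoloidalWindowDoorLrcModEntireThreadPins
import Summits.NavierStokesRegularity.NavierStokesRegularity.Theorems.PoloidalWindowDoorPoloidalWindowRigidityPoloidalExtremal
import Summits.NavierStokesRegularity.NavierStokesRegularity.Theorems.SqueezeCycleExtremalElementExistsExtraction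
import Literature.Analysis.FluidPDE.BarkerPrange2020VorticityAlignmentTypeIHolds

/-!
# Route `PoloidalWindowDoor`, crux `PoloidalWindowRigidity` (K2, stmt-NavierStokesRegularity-19708) — LINE 21 «hot_hull» (ns-idea-8): the HULL
# PACKAGE H0/H1/H3″/H3′/H3 as Theorems (helper S1+S2 of H6 `LeafRecurrence`), `Pinned` / `Peakless` / `hotSet` delta-unfolded

Cell ns-regularity-ideate, seat ns-poloidal-K2-p2 g14 (K2 stub-worker hand, H6 under DIRECTOR-NS #288).  These five statements are PROVED inside the
line workfile `Cruxes/PoloidalWindowRigidity/Lines/hot_hull.lean` (v1.6, 93916598275b24d6, H0 `curl_translate_arg` / H1 `pinned_translate`,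
`peakless_translate` / H3″ `peaklessClosed_holds` / H3′ `classCompactness_of_peaklessClosed` / H3 `hullLimit_of_compactness`, ns-idea-8 g10); a Cruxes
workfile is not importable from `Theorems/`, so they are PORTED here proof-for-proof (attribution: ns-idea-8), with the Cruxes-local packages unfolded,
for use by the H6 assembly (the sliding hull of an escaping hot end must consist of pinned peakless profiles).

H0 translation bookkeeping; H1 `pinned_translate` (class clauses by `…LeafUniformPins.class_translate`, pins re-derived by Fermat `…ThreadPins.threadPin_of_hotSpot`
/ `threadSignedPin`), `peakless_translate`; H3″ `peaklessClosed` (strict island brackets pull back); H3′ `classCompactness` (tree KNSS extraction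
`…Theorems.exists_tendsto_of_isTypeIAncientMild_seq`, poloidality by `…PoloidalExtremal.poloidal_of_tendsto`, vorticity slices by `curl = curlCLM ∘ D`);
H3 `hullLimit` (H3′ on the re-pinned translates).  Internal statements use capture-safe binder names (`q`); everything is definitionally the line's text.
WHAT THIS IS NOT: not a claim about Navier–Stokes regularity — compactness bookkeeping for the supports of a PASSed research decomposition of ⟨19708⟩'s
residues (bears_on LADDER-NS N0, rung N0-LocalTubeDoorPoloidal); the research cells stay OPEN; crux 19708 / item 20428 OPEN; NS regularity NOT proved.
-/

noncomputable section

-- the summit and its single sub-problem share the name (CONVENTIONS §1), as in every Theorems file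
set_option linter.dupNamespace false

namespace Summit.NavierStokesRegularity.NavierStokesRegularity.Theorems.PoloidalWindowDoorPoloidalWindowRigidityHotHullCompactness

open Set Function Filter Topology Metric
open scoped InnerProductSpace RealInnerProductSpace Laplacian NNReal
open Literature.Analysis Literature.Analysis.FluidPDE Literature.Analysis.UnboundedOperators
open Summit.NavierStokesRegularity.NavierStokesRegularity.Theorems

/-- The curl of a translate is the translated curl. -/
theorem curl_translate_arg (w : EuclideanSpace ℝ (Fin 3) → EuclideanSpace ℝ (Fin 3)) (c x : EuclideanSpace ℝ (Fin 3)) :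
    Literature.Analysis.FluidPDE.curl (fun y => w (y + c)) x = Literature.Analysis.FluidPDE.curl w (x + c) := by
  rw [curl_eq_curlCLM, curl_eq_curlCLM, fderiv_comp_add_right]

/-- Translates of divergence-free fields are divergence-free. -/
theorem isDivFree_translate_arg {w : EuclideanSpace ℝ (Fin 3) → EuclideanSpace ℝ (Fin 3)}
    (hw : Literature.Analysis.FluidPDE.VectorCalculus.IsDivFree w) (c : EuclideanSpace ℝ (Fin 3)) :
    Literature.Analysis.FluidPDE.VectorCalculus.IsDivFree (fun y => w (y + c)) := fun x => by
  have e : Literature.Analysis.FluidPDE.VectorCalculus.divergence (fun y => w (y + c)) x =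
      Literature.Analysis.FluidPDE.VectorCalculus.divergence w (x + c) := by
    simp only [Literature.Analysis.FluidPDE.VectorCalculus.divergence, fderiv_comp_add_right]
  rw [e, hw (x + c)]

/-- **H1a.**  The translate `v(·, · + y)` of a pinned profile by a hot point `y` is pinned (same `C`, same `N`); `Pinned` unfolded. -/
theorem pinned_translate {C : ℝ} {v : ℝ → EuclideanSpace ℝ (Fin 3) → EuclideanSpace ℝ (Fin 3)}
    (hP : (Literature.Analysis.FluidPDE.HasTypeITimeDecay C v ∧
        ContinuousOn (Function.uncurry v) (Set.Iio (0 : ℝ) ×ˢ Set.univ) ∧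
        (∀ s t : ℝ, s < t → t < 0 → ∀ x, v t x =
          Literature.Analysis.UnboundedOperators.heatExtension (v s) (t - s) x -
            Literature.Analysis.FluidPDE.oseenDuhamel 1 s v v t x) ∧
        (∀ t < 0, Literature.Analysis.FluidPDE.VectorCalculus.IsDivFree (v t)) ∧
        (∀ s < 0, ∀ q, ⟪Literature.Analysis.FluidPDE.curl (v s) q, EuclideanSpace.single 2 1⟫_ℝ = 0) ∧
        v (-1) 0 2 ≠ 0 ∧ (∀ t < 0, ∀ x, Real.sqrt (-t) * |v t x 2| ≤ |v (-1) 0 2|) ∧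
        (∀ h : EuclideanSpace ℝ (Fin 3), fderiv ℝ (v (-1)) 0 h 2 = 0) ∧
        (deriv (fun s => v s 0 2) (-1) = v (-1) 0 2 / 2 ∧ v (-1) 0 2 * (Δ (fun q => v (-1) q 2)) 0 ≤ 0)))
    {y : EuclideanSpace ℝ (Fin 3)} (hy : y ∈ {q : EuclideanSpace ℝ (Fin 3) | q 2 = 0 ∧ v (-1) q 2 = v (-1) 0 2}) :
    (Literature.Analysis.FluidPDE.HasTypeITimeDecay C (fun t x => v t (x + y)) ∧
      ContinuousOn (Function.uncurry (fun t x => v t (x + y))) (Set.Iio (0 : ℝ) ×ˢ Set.univ) ∧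
      (∀ s t : ℝ, s < t → t < 0 → ∀ x, (fun t x => v t (x + y)) t x =
        Literature.Analysis.UnboundedOperators.heatExtension ((fun t x => v t (x + y)) s) (t - s) x -
          Literature.Analysis.FluidPDE.oseenDuhamel 1 s (fun t x => v t (x + y)) (fun t x => v t (x + y)) t x) ∧
      (∀ t < 0, Literature.Analysis.FluidPDE.VectorCalculus.IsDivFree ((fun t x => v t (x + y)) t)) ∧
      (∀ s < 0, ∀ q, ⟪Literature.Analysis.FluidPDE.curl ((fun t x => v t (x + y)) s) q, EuclideanSpace.single 2 1⟫_ℝ = 0) ∧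
      (fun t x => v t (x + y)) (-1) 0 2 ≠ 0 ∧ (∀ t < 0, ∀ x, Real.sqrt (-t) * |(fun t x => v t (x + y)) t x 2| ≤ |(fun t x => v t (x + y)) (-1) 0 2|) ∧
      (∀ h : EuclideanSpace ℝ (Fin 3), fderiv ℝ ((fun t x => v t (x + y)) (-1)) 0 h 2 = 0) ∧
      (deriv (fun s => (fun t x => v t (x + y)) s 0 2) (-1) = (fun t x => v t (x + y)) (-1) 0 2 / 2 ∧ (fun t x => v t (x + y)) (-1) 0 2 * (Δ (fun q => (fun t x => v t (x + y)) (-1) q 2)) 0 ≤ 0)) := by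
  obtain ⟨hrate, hcont, hmild, hdiv, hpol, hne, hhot, -, -⟩ := hP
  obtain ⟨hrate', hcont', hmild'⟩ := PoloidalWindowDoorPoloidalWindowRigidityLeafUniformPins.class_translate hrate hcont hmild y
  have hyN : v (-1) y 2 = v (-1) 0 2 := hy.2
  have hdiv' : ∀ t < 0, Literature.Analysis.FluidPDE.VectorCalculus.IsDivFree ((fun t x => v t (x + y)) t) :=
    fun t ht => isDivFree_translate_arg (hdiv t ht) y
  have hpol' : ∀ s < 0, ∀ x, ⟪Literature.Analysis.FluidPDE.curl ((fun t x => v t (x + y)) s) x, EuclideanSpace.single 2 1⟫_ℝ = 0 := by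
    intro s hs x
    show ⟪Literature.Analysis.FluidPDE.curl (fun x' => v s (x' + y)) x, EuclideanSpace.single 2 1⟫_ℝ = 0
    rw [curl_translate_arg]
    exact hpol s hs (x + y)
  have hne' : (fun t x => v t (x + y)) (-1) 0 2 ≠ 0 := by
    show v (-1) (0 + y) 2 ≠ 0
    rw [zero_add, hyN]
    exact hne
  have hhot' : ∀ t < 0, ∀ x, Real.sqrt (-t) * |(fun t x => v t (x + y)) t x 2| ≤ |(fun t x => v t (x + y)) (-1) 0 2| := by
    intro t ht x
    show Real.sqrt (-t) * |v t (x + y) 2| ≤ |v (-1) (0 + y) 2|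
    rw [zero_add, hyN]
    exact hhot t ht (x + y)
  exact ⟨hrate', hcont', hmild', hdiv', hpol', hne', hhot',
    PoloidalWindowDoorLrcModEntireThreadPins.threadPin_of_hotSpot hrate' hcont' hmild' hhot',
    PoloidalWindowDoorLrcModEntireThreadPins.threadSignedPin C _ hrate' hcont' hmild' hdiv' hne' hhot'⟩

/-- **H1b.**  `Peakless` (unfolded) is invariant under every spatial translation. -/
theorem peakless_translate {v : ℝ → EuclideanSpace ℝ (Fin 3) → EuclideanSpace ℝ (Fin 3)}
    (hK : (∀ (s z₀ σ M : ℝ) (K O : Set (EuclideanSpace ℝ (Fin 3))), s < 0 →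
        ((σ = 1 ∨ σ = -1) ∧ IsCompact K ∧ K.Nonempty ∧ (∀ q ∈ K, q 2 = z₀ ∧ σ * v s q 2 = M) ∧
          IsOpen O ∧ K ⊆ O ∧ (∀ q ∈ O, q 2 = z₀ → σ * v s q 2 ≤ M) ∧
          (∀ q ∈ O, q 2 = z₀ → σ * v s q 2 = M → q ∈ K)) → False))
    (y : EuclideanSpace ℝ (Fin 3)) :
    (∀ (s z₀ σ M : ℝ) (K O : Set (EuclideanSpace ℝ (Fin 3))), s < 0 →
      ((σ = 1 ∨ σ = -1) ∧ IsCompact K ∧ K.Nonempty ∧ (∀ q ∈ K, q 2 = z₀ ∧ σ * (fun t x => v t (x + y)) s q 2 = M) ∧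
        IsOpen O ∧ K ⊆ O ∧ (∀ q ∈ O, q 2 = z₀ → σ * (fun t x => v t (x + y)) s q 2 ≤ M) ∧
        (∀ q ∈ O, q 2 = z₀ → σ * (fun t x => v t (x + y)) s q 2 = M → q ∈ K)) → False) := by
  intro s z₀ σ M K O hs h
  obtain ⟨hσ, hKc, hKne, hKval, hO, hKO, hOle, hOeq⟩ := h
  have hφ : Continuous fun x : EuclideanSpace ℝ (Fin 3) => x + y := by fun_prop
  have hOi : IsOpen ((fun x : EuclideanSpace ℝ (Fin 3) => x + y) '' O) := by
    have e : (fun x : EuclideanSpace ℝ (Fin 3) => x + y) '' O = (Homeomorph.addRight y) '' O := rfl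
    rw [e]
    exact (Homeomorph.addRight y).isOpenMap O hO
  refine hK s (z₀ + y 2) σ M ((fun x => x + y) '' K) ((fun x => x + y) '' O) hs
    ⟨hσ, hKc.image hφ, hKne.image _, ?_, hOi, Set.image_mono hKO, ?_, ?_⟩
  · rintro _ ⟨x, hx, rfl⟩
    refine ⟨?_, (hKval x hx).2⟩
    show (x + y) 2 = z₀ + y 2
    rw [PiLp.add_apply, (hKval x hx).1]
  · rintro _ ⟨x, hx, rfl⟩ hx2
    have hx2' : x 2 = z₀ := by
      have h' : x 2 + y 2 = z₀ + y 2 := by rw [← PiLp.add_apply]; exact hx2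
      linarith
    exact hOle x hx hx2'
  · rintro _ ⟨x, hx, rfl⟩ hx2 hval
    have hx2' : x 2 = z₀ := by
      have h' : x 2 + y 2 = z₀ + y 2 := by rw [← PiLp.add_apply]; exact hx2
      linarith
    exact ⟨x, hOeq x hx hx2' hval, rfl⟩

/-- **H3″ `peaklessClosed`.**  Strict island brackets of the limit pull back to the approximants; `Peakless` unfolded. -/
theorem peaklessClosed (vs : ℕ → ℝ → EuclideanSpace ℝ (Fin 3) → EuclideanSpace ℝ (Fin 3)) (U : ℝ → EuclideanSpace ℝ (Fin 3) → EuclideanSpace ℝ (Fin 3))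
    (hK : ∀ k, (∀ (s z₀ σ M : ℝ) (K O : Set (EuclideanSpace ℝ (Fin 3))), s < 0 →
        ((σ = 1 ∨ σ = -1) ∧ IsCompact K ∧ K.Nonempty ∧ (∀ q ∈ K, q 2 = z₀ ∧ σ * (vs k) s q 2 = M) ∧
          IsOpen O ∧ K ⊆ O ∧ (∀ q ∈ O, q 2 = z₀ → σ * (vs k) s q 2 ≤ M) ∧
          (∀ q ∈ O, q 2 = z₀ → σ * (vs k) s q 2 = M → q ∈ K)) → False))
    (hcvs : ∀ k, ∀ t < 0, Continuous (vs k t)) (hcU : ∀ t < 0, Continuous (U t))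
    (hconv : ∀ t < 0, TendstoLocallyUniformly (fun j => vs j t) (U t) Filter.atTop) :
    (∀ (s z₀ σ M : ℝ) (K O : Set (EuclideanSpace ℝ (Fin 3))), s < 0 →
      ((σ = 1 ∨ σ = -1) ∧ IsCompact K ∧ K.Nonempty ∧ (∀ q ∈ K, q 2 = z₀ ∧ σ * U s q 2 = M) ∧
        IsOpen O ∧ K ⊆ O ∧ (∀ q ∈ O, q 2 = z₀ → σ * U s q 2 ≤ M) ∧
        (∀ q ∈ O, q 2 = z₀ → σ * U s q 2 = M → q ∈ K)) → False) := by
  intro s z₀ σ M K O hs h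
  obtain ⟨hσ, hKc, hKne, hKval, hO, hKO, hOle, hOeq⟩ := h
  have hc2 : Continuous fun x : EuclideanSpace ℝ (Fin 3) => x 2 := by fun_prop
  have hPc : IsClosed {y : EuclideanSpace ℝ (Fin 3) | y 2 = z₀} := isClosed_eq hc2 continuous_const
  -- a closed thickening of `K` inside `O`
  obtain ⟨δ₀, hδ₀, hδ₀O⟩ := hKc.exists_cthickening_subset_open hO hKO
  set r : ℝ := δ₀ / 2 with hr_def
  have hr : 0 < r := by positivity
  have hrδ : r < δ₀ := by rw [hr_def]; linarith
  -- the compact sets `A := cthickening r K ∩ P`, `B := cthickening δ₀ K`, the ring `R := (B \ thickening r K) ∩ P`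
  have hAc : IsCompact (cthickening r K ∩ {y : EuclideanSpace ℝ (Fin 3) | y 2 = z₀}) := hKc.cthickening.inter_right hPc
  have hBc : IsCompact (cthickening δ₀ K) := hKc.cthickening
  have hRc : IsCompact ((cthickening δ₀ K \ thickening r K) ∩ {y : EuclideanSpace ℝ (Fin 3) | y 2 = z₀}) :=
    (hBc.diff isOpen_thickening).inter_right hPc
  have hKA : K ⊆ cthickening r K ∩ {y : EuclideanSpace ℝ (Fin 3) | y 2 = z₀} :=
    fun y hy => ⟨self_subset_cthickening K hy, (hKval y hy).1⟩
  have hKB : K ⊆ cthickening δ₀ K := self_subset_cthickening K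
  have hf : Continuous fun y => σ * U s y 2 := continuous_const.mul (hc2.comp (hcU s hs))
  -- strictness of the bracket on the ring
  have hRlt : ∀ y ∈ (cthickening δ₀ K \ thickening r K) ∩ {y : EuclideanSpace ℝ (Fin 3) | y 2 = z₀}, σ * U s y 2 < M := by
    rintro y ⟨⟨hyB, hynt⟩, hyP⟩
    have hyO : y ∈ O := hδ₀O hyB
    rcases (hOle y hyO hyP).lt_or_eq with hlt | heq
    · exact hlt
    · exact absurd (self_subset_thickening hr K (hOeq y hyO hyP heq)) hynt
  -- a margin `δ > 0` on the ring
  obtain ⟨δ, hδ, hRle⟩ : ∃ δ > 0, ∀ y ∈ (cthickening δ₀ K \ thickening r K) ∩ {y : EuclideanSpace ℝ (Fin 3) | y 2 = z₀},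
      σ * U s y 2 ≤ M - 3 * δ := by
    by_cases hRne : ((cthickening δ₀ K \ thickening r K) ∩ {y : EuclideanSpace ℝ (Fin 3) | y 2 = z₀}).Nonempty
    · obtain ⟨y₀, hy₀, hmax⟩ := hRc.exists_isMaxOn hRne hf.continuousOn
      refine ⟨(M - σ * U s y₀ 2) / 3, by linarith [hRlt y₀ hy₀], fun y hy => ?_⟩
      have h1 : σ * U s y 2 ≤ σ * U s y₀ 2 := hmax hy
      linarith
    · exact ⟨1, one_pos, fun y hy => (hRne ⟨y, hy⟩).elim⟩
  -- uniform convergence on the compact `B`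
  have hunif : TendstoUniformlyOn (fun j => vs j s) (U s) atTop (cthickening δ₀ K) :=
    (tendstoLocallyUniformly_iff_forall_isCompact.1 (hconv s hs)) _ hBc
  obtain ⟨j, hj⟩ := ((Metric.tendstoUniformlyOn_iff.1 hunif) δ hδ).exists
  have hσ1 : |σ| = 1 := by rcases hσ with h1 | h1 <;> simp [h1]
  have hclose : ∀ y ∈ cthickening δ₀ K, |σ * vs j s y 2 - σ * U s y 2| < δ := by
    intro y hy
    have h1 : dist (U s y 2) (vs j s y 2) ≤ dist (U s y) (vs j s y) := PiLp.dist_apply_le (U s y) (vs j s y) 2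
    have h2 := hj y hy
    rw [Real.dist_eq] at h1
    calc |σ * vs j s y 2 - σ * U s y 2| = |σ| * |vs j s y 2 - U s y 2| := by rw [← mul_sub, abs_mul]
      _ = |U s y 2 - vs j s y 2| := by rw [hσ1, one_mul, abs_sub_comm]
      _ < δ := lt_of_le_of_lt h1 h2
  -- the maximisers of `σ(v_j)₂` over `A`
  have hg : Continuous fun y => σ * vs j s y 2 := continuous_const.mul (hc2.comp (hcvs j s hs))
  have hAne : (cthickening r K ∩ {y : EuclideanSpace ℝ (Fin 3) | y 2 = z₀}).Nonempty := hKne.mono hKA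
  obtain ⟨y₁, hy₁A, hmax₁⟩ := hAc.exists_isMaxOn hAne hg.continuousOn
  obtain ⟨yK, hyK⟩ := hKne
  have hMj : M - δ < σ * vs j s y₁ 2 := by
    have h1 : σ * vs j s yK 2 ≤ σ * vs j s y₁ 2 := hmax₁ (hKA hyK)
    have h2 := hclose yK (hKB hyK)
    rw [(hKval yK hyK).2] at h2
    have h3 := (abs_lt.1 h2).1
    linarith
  -- on the ring, `σ(v_j)₂ < M − δ < M_j`
  have hring : ∀ y ∈ thickening δ₀ K, y 2 = z₀ → y ∉ cthickening r K → σ * vs j s y 2 < M - δ := by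
    intro y hyO hyP hyA
    have hyB : y ∈ cthickening δ₀ K := thickening_subset_cthickening δ₀ K hyO
    have hyR : y ∈ (cthickening δ₀ K \ thickening r K) ∩ {y : EuclideanSpace ℝ (Fin 3) | y 2 = z₀} :=
      ⟨⟨hyB, fun h' => hyA (thickening_subset_cthickening r K h')⟩, hyP⟩
    have h1 := hRle y hyR
    have h2 := (abs_lt.1 (hclose y hyB)).2
    linarith
  -- the island bracket of `v_j`: contradiction with `Peakless (vs j)`
  refine hK j s z₀ σ (σ * vs j s y₁ 2)
    ((cthickening r K ∩ {y : EuclideanSpace ℝ (Fin 3) | y 2 = z₀}) ∩ {y | σ * vs j s y 2 = σ * vs j s y₁ 2})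
    (thickening δ₀ K) hs ⟨hσ, hAc.inter_right (isClosed_eq hg continuous_const), ⟨y₁, hy₁A, rfl⟩,
      fun y hy => ⟨hy.1.2, hy.2⟩, isOpen_thickening, fun y hy => cthickening_subset_thickening' hδ₀ hrδ K hy.1.1, ?_, ?_⟩
  · intro y hyO hyP
    by_cases hyA : y ∈ cthickening r K
    · exact hmax₁ ⟨hyA, hyP⟩
    · have := hring y hyO hyP hyA
      linarith
  · intro y hyO hyP hyM
    by_cases hyA : y ∈ cthickening r K
    · exact ⟨⟨hyA, hyP⟩, hyM⟩
    · have := hring y hyO hyP hyA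
      linarith

/-- Slices of a profile of the class are continuous. -/
theorem continuous_slice_of_class {C : ℝ} {v : ℝ → EuclideanSpace ℝ (Fin 3) → EuclideanSpace ℝ (Fin 3)}
    (hrate : HasTypeITimeDecay C v) (hcont : ContinuousOn (uncurry v) (Iio (0 : ℝ) ×ˢ univ))
    (hmild : ∀ s t : ℝ, s < t → t < 0 → ∀ x, v t x = heatExtension (v s) (t - s) x - oseenDuhamel 1 s v v t x)
    (hdiv : ∀ t < 0, VectorCalculus.IsDivFree (v t)) {t : ℝ} (ht : t < 0) : Continuous (v t) :=
  ((PoloidalWindowDoorPoloidalWindowRigidityWindow.isTypeIAncientMild_of_class hrate hcont hmild hdiv).analyticOnNhd_slice_univ ht).continuous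

/-- **H3′ `classCompactness`.**  `Pinned` / `Peakless` unfolded. -/
theorem classCompactness (C : ℝ) (vs : ℕ → ℝ → EuclideanSpace ℝ (Fin 3) → EuclideanSpace ℝ (Fin 3))
    (hP : ∀ k, (Literature.Analysis.FluidPDE.HasTypeITimeDecay C (vs k) ∧
        ContinuousOn (Function.uncurry (vs k)) (Set.Iio (0 : ℝ) ×ˢ Set.univ) ∧
        (∀ s t : ℝ, s < t → t < 0 → ∀ x, (vs k) t x =
          Literature.Analysis.UnboundedOperators.heatExtension ((vs k) s) (t - s) x -
            Literature.Analysis.FluidPDE.oseenDuhamel 1 s (vs k) (vs k) t x) ∧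
        (∀ t < 0, Literature.Analysis.FluidPDE.VectorCalculus.IsDivFree ((vs k) t)) ∧
        (∀ s < 0, ∀ q, ⟪Literature.Analysis.FluidPDE.curl ((vs k) s) q, EuclideanSpace.single 2 1⟫_ℝ = 0) ∧
        (vs k) (-1) 0 2 ≠ 0 ∧ (∀ t < 0, ∀ x, Real.sqrt (-t) * |(vs k) t x 2| ≤ |(vs k) (-1) 0 2|) ∧
        (∀ h : EuclideanSpace ℝ (Fin 3), fderiv ℝ ((vs k) (-1)) 0 h 2 = 0) ∧
        (deriv (fun s => (vs k) s 0 2) (-1) = (vs k) (-1) 0 2 / 2 ∧ (vs k) (-1) 0 2 * (Δ (fun q => (vs k) (-1) q 2)) 0 ≤ 0)))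
    (hK : ∀ k, (∀ (s z₀ σ M : ℝ) (K O : Set (EuclideanSpace ℝ (Fin 3))), s < 0 →
        ((σ = 1 ∨ σ = -1) ∧ IsCompact K ∧ K.Nonempty ∧ (∀ q ∈ K, q 2 = z₀ ∧ σ * (vs k) s q 2 = M) ∧
          IsOpen O ∧ K ⊆ O ∧ (∀ q ∈ O, q 2 = z₀ → σ * (vs k) s q 2 ≤ M) ∧
          (∀ q ∈ O, q 2 = z₀ → σ * (vs k) s q 2 = M → q ∈ K)) → False))
    (hN : ∀ k, vs k (-1) 0 2 = vs 0 (-1) 0 2) :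
    ∃ (φ : ℕ → ℕ) (U : ℝ → EuclideanSpace ℝ (Fin 3) → EuclideanSpace ℝ (Fin 3)), StrictMono φ ∧
      (Literature.Analysis.FluidPDE.HasTypeITimeDecay C U ∧
        ContinuousOn (Function.uncurry U) (Set.Iio (0 : ℝ) ×ˢ Set.univ) ∧
        (∀ s t : ℝ, s < t → t < 0 → ∀ x, U t x =
          Literature.Analysis.UnboundedOperators.heatExtension (U s) (t - s) x -
            Literature.Analysis.FluidPDE.oseenDuhamel 1 s U U t x) ∧
        (∀ t < 0, Literature.Analysis.FluidPDE.VectorCalculus.IsDivFree (U t)) ∧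
        (∀ s < 0, ∀ q, ⟪Literature.Analysis.FluidPDE.curl (U s) q, EuclideanSpace.single 2 1⟫_ℝ = 0) ∧
        U (-1) 0 2 ≠ 0 ∧ (∀ t < 0, ∀ x, Real.sqrt (-t) * |U t x 2| ≤ |U (-1) 0 2|) ∧
        (∀ h : EuclideanSpace ℝ (Fin 3), fderiv ℝ (U (-1)) 0 h 2 = 0) ∧
        (deriv (fun s => U s 0 2) (-1) = U (-1) 0 2 / 2 ∧ U (-1) 0 2 * (Δ (fun q => U (-1) q 2)) 0 ≤ 0)) ∧
      (∀ (s z₀ σ M : ℝ) (K O : Set (EuclideanSpace ℝ (Fin 3))), s < 0 →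
        ((σ = 1 ∨ σ = -1) ∧ IsCompact K ∧ K.Nonempty ∧ (∀ q ∈ K, q 2 = z₀ ∧ σ * U s q 2 = M) ∧
          IsOpen O ∧ K ⊆ O ∧ (∀ q ∈ O, q 2 = z₀ → σ * U s q 2 ≤ M) ∧
          (∀ q ∈ O, q 2 = z₀ → σ * U s q 2 = M → q ∈ K)) → False) ∧
      (∀ t < 0, TendstoLocallyUniformly (fun j => vs (φ j) t) (U t) Filter.atTop) ∧
      TendstoLocallyUniformly (fun j => Literature.Analysis.FluidPDE.curl (vs (φ j) (-1)))
        (Literature.Analysis.FluidPDE.curl (U (-1))) Filter.atTop := by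
  have hw : ∀ k, IsTypeIAncientMild C (vs k) := fun k =>
    PoloidalWindowDoorPoloidalWindowRigidityWindow.isTypeIAncientMild_of_class (hP k).1 (hP k).2.1 (hP k).2.2.1 (hP k).2.2.2.1
  obtain ⟨φ, hφ, W, hW, hpt, hfd, htlu, htlufd⟩ :=
    exists_tendsto_of_isTypeIAncientMild_seq C hw
  -- the four class clauses of the limit
  have hrate : Literature.Analysis.FluidPDE.HasTypeITimeDecay C W := hW.2.2.2
  have hcont : ContinuousOn (Function.uncurry W) (Set.Iio (0 : ℝ) ×ˢ Set.univ) := hW.1.continuousOn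
  have hmild : ∀ s t : ℝ, s < t → t < 0 → ∀ x, W t x =
      Literature.Analysis.UnboundedOperators.heatExtension (W s) (t - s) x -
        Literature.Analysis.FluidPDE.oseenDuhamel 1 s W W t x :=
    fun s t hst ht x => hW.mild_eq_heatExtension hst ht x
  have hdiv : ∀ t < 0, Literature.Analysis.FluidPDE.VectorCalculus.IsDivFree (W t) := hW.2.1
  -- poloidality passes to the limit (pointwise convergence of derivatives)
  have hpol : ∀ s < 0, ∀ y, ⟪Literature.Analysis.FluidPDE.curl (W s) y, EuclideanSpace.single 2 1⟫_ℝ = 0 :=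
    fun s hs y => PoloidalWindowDoorPoloidalWindowRigidityPoloidalExtremal.poloidal_of_tendsto (hfd s hs y)
      (fun j => (hP (φ j)).2.2.2.2.1 s hs y)
  -- the common hot value passes to the limit
  have hc2 : Continuous fun x : EuclideanSpace ℝ (Fin 3) => x 2 := by fun_prop
  have hval : ∀ t < 0, ∀ x, Tendsto (fun j => vs (φ j) t x 2) atTop (𝓝 (W t x 2)) :=
    fun t ht x => (hc2.tendsto _).comp (hpt t ht x)
  have hWN : W (-1) 0 2 = vs 0 (-1) 0 2 := by
    have h1 := hval (-1) (by norm_num) 0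
    have h2 : (fun j => vs (φ j) (-1) 0 2) = fun _ => vs 0 (-1) 0 2 := funext fun j => hN (φ j)
    rw [h2] at h1
    exact (tendsto_nhds_unique h1 tendsto_const_nhds).symm ▸ rfl
  have hne : W (-1) 0 2 ≠ 0 := by
    rw [hWN]
    exact (hP 0).2.2.2.2.2.1
  -- the Type-I extremality passes to the limit
  have hhot : ∀ t < 0, ∀ x, Real.sqrt (-t) * |W t x 2| ≤ |W (-1) 0 2| := by
    intro t ht x
    have hlim : Tendsto (fun j => Real.sqrt (-t) * |vs (φ j) t x 2|) atTop (𝓝 (Real.sqrt (-t) * |W t x 2|)) :=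
      ((continuous_const.mul continuous_abs).tendsto _).comp (hval t ht x)
    refine le_of_tendsto hlim (Eventually.of_forall fun j => ?_)
    have h := (hP (φ j)).2.2.2.2.2.2.1 t ht x
    rw [hN (φ j)] at h
    rw [hWN]
    exact h
  -- the pins re-derive themselves by Fermat at the hot spot of the limit
  have hPW :
      (Literature.Analysis.FluidPDE.HasTypeITimeDecay C W ∧
        ContinuousOn (Function.uncurry W) (Set.Iio (0 : ℝ) ×ˢ Set.univ) ∧
        (∀ s t : ℝ, s < t → t < 0 → ∀ x, W t x =
          Literature.Analysis.UnboundedOperators.heatExtension (W s) (t - s) x -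
            Literature.Analysis.FluidPDE.oseenDuhamel 1 s W W t x) ∧
        (∀ t < 0, Literature.Analysis.FluidPDE.VectorCalculus.IsDivFree (W t)) ∧
        (∀ s < 0, ∀ q, ⟪Literature.Analysis.FluidPDE.curl (W s) q, EuclideanSpace.single 2 1⟫_ℝ = 0) ∧
        W (-1) 0 2 ≠ 0 ∧ (∀ t < 0, ∀ x, Real.sqrt (-t) * |W t x 2| ≤ |W (-1) 0 2|) ∧
        (∀ h : EuclideanSpace ℝ (Fin 3), fderiv ℝ (W (-1)) 0 h 2 = 0) ∧
        (deriv (fun s => W s 0 2) (-1) = W (-1) 0 2 / 2 ∧ W (-1) 0 2 * (Δ (fun q => W (-1) q 2)) 0 ≤ 0)) :=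
    ⟨hrate, hcont, hmild, hdiv, hpol, hne, hhot,
      PoloidalWindowDoorLrcModEntireThreadPins.threadPin_of_hotSpot hrate hcont hmild hhot,
      PoloidalWindowDoorLrcModEntireThreadPins.threadSignedPin C W hrate hcont hmild hdiv hne hhot⟩
  -- `Peakless` passes to the limit (H3″)
  have hKW :
      (∀ (s z₀ σ M : ℝ) (K O : Set (EuclideanSpace ℝ (Fin 3))), s < 0 →
        ((σ = 1 ∨ σ = -1) ∧ IsCompact K ∧ K.Nonempty ∧ (∀ q ∈ K, q 2 = z₀ ∧ σ * W s q 2 = M) ∧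
          IsOpen O ∧ K ⊆ O ∧ (∀ q ∈ O, q 2 = z₀ → σ * W s q 2 ≤ M) ∧
          (∀ q ∈ O, q 2 = z₀ → σ * W s q 2 = M → q ∈ K)) → False) :=
    peaklessClosed (fun j => vs (φ j)) W (fun j => hK (φ j)) (fun j t ht => continuous_slice_of_class (hP (φ j)).1 (hP (φ j)).2.1 (hP (φ j)).2.2.1 (hP (φ j)).2.2.2.1 ht)
      (fun t ht => continuous_slice_of_class hrate hcont hmild hdiv ht) (fun t ht => htlu t ht)
  -- vorticity slices converge locally uniformly: `curl = curlCLM ∘ D`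
  have hcurl : TendstoLocallyUniformly (fun j => Literature.Analysis.FluidPDE.curl (vs (φ j) (-1)))
      (Literature.Analysis.FluidPDE.curl (W (-1))) atTop := by
    have e1 : (fun j => Literature.Analysis.FluidPDE.curl (vs (φ j) (-1))) = fun j => curlCLM ∘ fderiv ℝ (vs (φ j) (-1)) := by
      funext j x; exact curl_eq_curlCLM _ _
    have e2 : Literature.Analysis.FluidPDE.curl (W (-1)) = curlCLM ∘ fderiv ℝ (W (-1)) := by
      funext x; exact curl_eq_curlCLM _ _
    rw [e1, e2]
    exact curlCLM.uniformContinuous.comp_tendstoLocallyUniformly (htlufd (-1) (by norm_num))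
  exact ⟨φ, W, hφ, hPW, hKW, fun t ht => htlu t ht, hcurl⟩

/-- **H3 `hullLimit`.**  Along a sequence of hot points a subsequence of the re-pinned translates converges, locally uniformly on every slice and with the
vorticity slice at `−1`, to a pinned peakless profile; `Pinned` / `Peakless` / `hotSet` unfolded. -/
theorem hullLimit (C : ℝ) (v : ℝ → EuclideanSpace ℝ (Fin 3) → EuclideanSpace ℝ (Fin 3))
    (hP : (Literature.Analysis.FluidPDE.HasTypeITimeDecay C v ∧
        ContinuousOn (Function.uncurry v) (Set.Iio (0 : ℝ) ×ˢ Set.univ) ∧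
        (∀ s t : ℝ, s < t → t < 0 → ∀ x, v t x =
          Literature.Analysis.UnboundedOperators.heatExtension (v s) (t - s) x -
            Literature.Analysis.FluidPDE.oseenDuhamel 1 s v v t x) ∧
        (∀ t < 0, Literature.Analysis.FluidPDE.VectorCalculus.IsDivFree (v t)) ∧
        (∀ s < 0, ∀ q, ⟪Literature.Analysis.FluidPDE.curl (v s) q, EuclideanSpace.single 2 1⟫_ℝ = 0) ∧
        v (-1) 0 2 ≠ 0 ∧ (∀ t < 0, ∀ x, Real.sqrt (-t) * |v t x 2| ≤ |v (-1) 0 2|) ∧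
        (∀ h : EuclideanSpace ℝ (Fin 3), fderiv ℝ (v (-1)) 0 h 2 = 0) ∧
        (deriv (fun s => v s 0 2) (-1) = v (-1) 0 2 / 2 ∧ v (-1) 0 2 * (Δ (fun q => v (-1) q 2)) 0 ≤ 0)))
    (hK : (∀ (s z₀ σ M : ℝ) (K O : Set (EuclideanSpace ℝ (Fin 3))), s < 0 →
        ((σ = 1 ∨ σ = -1) ∧ IsCompact K ∧ K.Nonempty ∧ (∀ q ∈ K, q 2 = z₀ ∧ σ * v s q 2 = M) ∧
          IsOpen O ∧ K ⊆ O ∧ (∀ q ∈ O, q 2 = z₀ → σ * v s q 2 ≤ M) ∧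
          (∀ q ∈ O, q 2 = z₀ → σ * v s q 2 = M → q ∈ K)) → False))
    (y : ℕ → EuclideanSpace ℝ (Fin 3)) (hy : ∀ k, y k ∈ {q : EuclideanSpace ℝ (Fin 3) | q 2 = 0 ∧ v (-1) q 2 = v (-1) 0 2}) :
    ∃ (φ : ℕ → ℕ) (U : ℝ → EuclideanSpace ℝ (Fin 3) → EuclideanSpace ℝ (Fin 3)), StrictMono φ ∧
      (Literature.Analysis.FluidPDE.HasTypeITimeDecay C U ∧
        ContinuousOn (Function.uncurry U) (Set.Iio (0 : ℝ) ×ˢ Set.univ) ∧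
        (∀ s t : ℝ, s < t → t < 0 → ∀ x, U t x =
          Literature.Analysis.UnboundedOperators.heatExtension (U s) (t - s) x -
            Literature.Analysis.FluidPDE.oseenDuhamel 1 s U U t x) ∧
        (∀ t < 0, Literature.Analysis.FluidPDE.VectorCalculus.IsDivFree (U t)) ∧
        (∀ s < 0, ∀ q, ⟪Literature.Analysis.FluidPDE.curl (U s) q, EuclideanSpace.single 2 1⟫_ℝ = 0) ∧
        U (-1) 0 2 ≠ 0 ∧ (∀ t < 0, ∀ x, Real.sqrt (-t) * |U t x 2| ≤ |U (-1) 0 2|) ∧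
        (∀ h : EuclideanSpace ℝ (Fin 3), fderiv ℝ (U (-1)) 0 h 2 = 0) ∧
        (deriv (fun s => U s 0 2) (-1) = U (-1) 0 2 / 2 ∧ U (-1) 0 2 * (Δ (fun q => U (-1) q 2)) 0 ≤ 0)) ∧
      (∀ (s z₀ σ M : ℝ) (K O : Set (EuclideanSpace ℝ (Fin 3))), s < 0 →
        ((σ = 1 ∨ σ = -1) ∧ IsCompact K ∧ K.Nonempty ∧ (∀ q ∈ K, q 2 = z₀ ∧ σ * U s q 2 = M) ∧
          IsOpen O ∧ K ⊆ O ∧ (∀ q ∈ O, q 2 = z₀ → σ * U s q 2 ≤ M) ∧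
          (∀ q ∈ O, q 2 = z₀ → σ * U s q 2 = M → q ∈ K)) → False) ∧
      (∀ t < 0, TendstoLocallyUniformly (fun j x => v t (x + y (φ j))) (U t) Filter.atTop) ∧
      TendstoLocallyUniformly (fun j x => Literature.Analysis.FluidPDE.curl (v (-1)) (x + y (φ j)))
        (Literature.Analysis.FluidPDE.curl (U (-1))) Filter.atTop := by
  obtain ⟨φ, U, hφ, hPU, hPkU, hconv, hcurl⟩ := classCompactness C (fun k t x => v t (x + y k)) (fun k => pinned_translate hP (hy k))
    (fun k => peakless_translate hK (y k))
    (fun k => by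
      show v (-1) (0 + y k) 2 = v (-1) (0 + y 0) 2
      rw [zero_add, zero_add, (hy k).2, (hy 0).2])
  refine ⟨φ, U, hφ, hPU, hPkU, fun t ht => hconv t ht, ?_⟩
  have e : (fun j => Literature.Analysis.FluidPDE.curl ((fun k t x => v t (x + y k)) (φ j) (-1))) =
      fun j x => Literature.Analysis.FluidPDE.curl (v (-1)) (x + y (φ j)) := by
    funext j x
    exact curl_translate_arg (v (-1)) (y (φ j)) x
  rw [e] at hcurl
  exact hcurl

end Summit.NavierStokesRegularity.NavierStokesRegularity.Theorems.PoloidalWindowDoorPoloidalWindowRigidityHotHullCompactness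

end
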